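import Mathlib

/-!
# Toy instance of the exceptional-block covariance term (drefute gen 2, pre-audit §2(b) of the GV repair)

A rank-2 "exceptional multiplet": normalised transfer matrix `t = diag(1, x)` (vacuum `x_Ω = 1`, one flux
quasi-vacuum with `x = e^{-ε} ∈ (0,1)`), and two perfectly sector-BLIND one-step observables `â = b̂ = 1`
(`a₀ = b₀ = 1`, time extents `c_A = c_B = 1`, so `α = β′ = 2c − 1 = 1`).  On the symmetric torus of time
period `N` the transfer-matrix formula gives, for EVERY separation `n`,
`⟨A τ_n B⟩ = Tr(t^{N-2})/Tr(t^N)` and `⟨A⟩ = ⟨B⟩ = Tr(t^{N-1})/Tr(t^N)`, hence the connected correlator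
`corr(n) = (1 + x^{N-2})/(1 + x^N) − (1 + x^{N-1})²/(1 + x^N)²` — independent of `n`, and NON-ZERO:
it equals `x^{N-2} (1 − x)² / (1 + x^N)²` (`≈ ε²/4` for `Nε ≪ 1`, = `Var_w(ε)·αβ′`).  So a near-degenerate
multiplet with UNEQUAL splittings produces an `n`-independent connected term even for perfectly blind local
observables: any repair of `stub_gapStability` by "gap modulo ≤ D exceptional states" must also export a
two-sided window on the exceptional eigenvalues (or the block decomposition cannot reach `e^{-(m/4) n}`).
-/

namespace Summit.QuantumFields.YangMills.Cruxes.ClusteringToYangMills.DrefuteGen2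

/-- Closed form of the toy connected correlator (rank-2 exceptional block, blind unit observables). -/
theorem toy_corr_eq (x : ℝ) (N : ℕ) (hN : 2 ≤ N) (hden : 1 + x ^ N ≠ 0) :
    (1 + x ^ (N - 2)) / (1 + x ^ N) - (1 + x ^ (N - 1)) ^ 2 / (1 + x ^ N) ^ 2 =
      x ^ (N - 2) * (1 - x) ^ 2 / (1 + x ^ N) ^ 2 := by
  obtain ⟨k, rfl⟩ : ∃ k, N = k + 2 := ⟨N - 2, by omega⟩
  have h1 : k + 2 - 2 = k := by omega
  have h2 : k + 2 - 1 = k + 1 := by omega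
  rw [h1, h2] at *
  rw [div_sub_div _ _ hden (pow_ne_zero 2 hden), div_eq_div_iff (mul_ne_zero hden (pow_ne_zero 2 hden))
    (pow_ne_zero 2 hden)]
  ring

/-- It is strictly positive for `0 < x < 1` (unequal splittings), whatever `N ≥ 2`. -/
theorem toy_corr_pos (x : ℝ) (hx0 : 0 < x) (hx1 : x < 1) (N : ℕ) (hN : 2 ≤ N) :
    0 < (1 + x ^ (N - 2)) / (1 + x ^ N) - (1 + x ^ (N - 1)) ^ 2 / (1 + x ^ N) ^ 2 := by
  have hden : 1 + x ^ N ≠ 0 := by positivity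
  rw [toy_corr_eq x N hN hden]
  have h1 : 0 < (1 - x) ^ 2 := by
    have : 0 < 1 - x := by linarith
    positivity
  positivity

/-- It vanishes at `x = 1` (equal splittings: a genuinely degenerate doublet is invisible to blind observables). -/
theorem toy_corr_one (N : ℕ) (hN : 2 ≤ N) :
    (1 + (1 : ℝ) ^ (N - 2)) / (1 + 1 ^ N) - (1 + 1 ^ (N - 1)) ^ 2 / (1 + 1 ^ N) ^ 2 = 0 := by
  rw [toy_corr_eq 1 N hN (by norm_num)]
  simp

/-- Numerical instance: `N = 4`, `x = 1/2` gives `corr = 16/289` at every separation `n`. -/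
example : (1 + (1 / 2 : ℝ) ^ (4 - 2)) / (1 + (1 / 2) ^ 4) - (1 + (1 / 2) ^ (4 - 1)) ^ 2 / (1 + (1 / 2) ^ 4) ^ 2
    = 16 / 289 := by
  norm_num

end Summit.QuantumFields.YangMills.Cruxes.ClusteringToYangMills.DrefuteGen2
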